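import Summits.QuantumFields.YangMills.Theorems.BalabanUVNodesN15CurvedGluingSmoothCutDressedGluedAdjointRightInverse
import Summits.QuantumFields.YangMills.Theorems.BalabanUVNodesN15CurvedGluingCubeSmoothCutAdjointLetter
import HarnessLib

/-!
# ENTRY 2 `Y∘∇⁻_ν` FOR ANY RIGHT INVERSE `Y`, THE TRUE RIGHT-LOCALITY DEFECTS PRODUCED FROM FLAT DATA — n15-c∕168 ★★★ with `hloc`∕`hEd` DERIVED by FILE 148's right locality with defect
# (`X_kΔM_{h_k} = M_{h_k} + Ñ_{𝒲_k}F^flat_k`), the adjoint letter `θ_𝒲` DERIVED by FILE 150 (𝒲 by parts onto the sandwiched right entries), the far defect `F := 0` (global species model)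
# (dag-n15-c g19, n15-c∕173; N15 = NE2, s1 road (c) — the shape the cover∕small-field files instantiate)

Cell `pub-ymgap`, seat `pub-ymgap-dag-n15-c` (R134 (a); HUMAN RULING D-0062), generation 19.  `bears_on: R4∕N15 · K3⁸ SpineGivenEndpointR13SepCoPHV (stmt-QuantumFields-27366)`.
Filed `--kind proof --supports stmt-QuantumFields-27366 --as helper` — COUNT-NEUTRAL.  Theorems only; 0 `def`, 0 `sorry`.  Imports BY NAME n15-c∕168 `…SmoothCutDressedGluedAdjointRightInverse`
(★★★ `hasMaj_rightInverse_bgrad_smoothCutDressed`), FILE 148 `…CurvedGluingCubeDressedAdjointForm` (`projO_dressedV_comp_lap_mulOp`, `hasMaj_neumannR_comp_loc₂`, `isUnit_neumannR`) and FILE 150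
`…CurvedGluingCubeSmoothCutAdjointLetter` (★★★ `hasMaj_adjW_smoothCut_loc₂`).  Nothing in the tree is modified; nothing restated.

WHY.  At the cover in the global small-field gauge the global operator IS the cubes' common model `Σ∇̂*∇̂ + N_L − V∘jet` (global species `V = unstackM C A + N_V`, no per-cube far defect), and the
TRUE right-locality defect of the dressed smooth-cut cube `X_k` on the partition is `Ẽ_k = Ñ_{𝒲_k}∘F^flat_k` where `F^flat_k` is the CUT FLAT cube's defect `(M_χ̃N_k)(Σ∇̂*∇̂ + N_L)M_{h_k} =
M_{h_k} + F^flat_k` (FINDING g19-i; n15-c∕170–171 compute `F^flat` at the cover EXACTLY — the images cube leaks the nonlocal `aQ*Q − ∂Π∂*` through its faces).  THIS FILE packages the generic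
step: from `F^flat_k` (cut by `χ_k` on the left and `ψ_{2,k}` on the right, row `ε_F` at rate `ρ₁`), the global species letters `r_C`, `r_A`, `r_∇` (for FILE 150's `θ_𝒲 ≤ βr_C + |J|2(β^Qr_A +
βr_∇) + βR_Nc_r ≤ θ_A`) and a right inverse `Y`, the bound of n15-c∕168 for `Y∘∇⁻_ν` — so that the cover files only have to produce flat∕cover rows by name.

WHAT.  ★★★ `hasMaj_rightInverse_bgrad_smoothCutDressed_of_flat`: n15-c∕168's hypotheses with `hcov`∕`hFK`∕`hloc`∕`hEd`∕`hW𝒲` REPLACED by `hcov₀` (global model), `hflat`∕`hFlχ`∕`hFlψ`∕`hFl`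
(the cut flat cube's right-locality defect), `hC`∕`hgAf`∕`hgAb` (species letters), `hθAle`∕`hεEle` (the derived letters dominated by the displayed `θ_A`, `ε_E`), the right entries' rows at
the cut-row rate `δ`, `ρ₂ + 2σ ≤ ρ₁ ≤ δ_N`; SAME conclusion as n15-c∕168 (far letter `θ_F ≥ 0` kept as slack).

HONEST FRAMING ∕ LIMITS.  Composition of LANDED∕typed theorems over DISPLAYED rows on dag-n15-a's model carriers; proves NO estimate of a concrete propagator; nothing of [B5]∕[B6]∕[B9]
asserted ((2.91)–(2.93) p.239, (2.133)–(2.136) p.247, (3.42) p.397, (3.62)–(3.65) pp.402–403 = SHAPES ∕ MECHANISM).  NE2 for non-abelian `G(U)` NOT proved (C-N15-1); N15 booked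
«discharged AS CONSUMED at the U-blind v7 pin» (№253) — road (c)'s bookkeeping, NO count; K3⁸ skeleton untouched; one finite 𝕋⁴ at fixed ε — NOT infinite volume, NOT OS, NOT a mass gap,
NOT Clay.  Restate-immune (no Theses import).
-/

set_option autoImplicit false

noncomputable section
open scoped BigOperators Matrix
open Finset

namespace Summit.QuantumFields.YangMills.BalabanUVNodes.N15.Gluing

open Literature.MathematicalPhysics.QuantumFieldTheory.Balaban1983to89
open Literature.MathematicalPhysics.QuantumFieldTheory.Balaban1983to89.B11SectG (BlockNorm HasMaj RowSum hasMaj_zero)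
open Literature.MathematicalPhysics.QuantumFieldTheory.Balaban1983to89.B6RandomWalk (Triangle254)
open Literature.MathematicalPhysics.QuantumFieldTheory.Balaban1983to89.B6Prop26Gluing (mulOp mulOp_apply ind ind_nonneg ind_le_one)
open Summit.QuantumFields.YangMills.BalabanUVNodes.N15.MatrixSpecies (mmulOp liftBlk liftEquiv liftEquiv_apply liftEquiv_symm_apply)
open Summit.QuantumFields.YangMills.BalabanUVNodes.N15.BackgroundLayer (fgrad bgrad fgradAdj fgrad_apply bgrad_apply stack projO unstackM bgPropV blkPair fgradMat)
open Summit.QuantumFields.YangMills.BalabanUVNodes.N15.CurvedSpecies (hasMaj_smoothCut_flat hasMaj_jet_smoothCut_flat smoothCut_out hasMaj_dressedV_pair)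

/-! ## Entry 2 for any right inverse, from flat data -/

section Capstone

variable {X ι J K : Type} [Fintype X] [DecidableEq X] [Fintype ι] [DecidableEq ι] [Fintype J] [DecidableEq J] [Fintype K] {g : B6.Geometry} (blk : X → g.Site) (τ : J → X ≃ X) (n : ℝ) (ν : J)
  {σ cr : ℝ} {N : K → (X × ι → ℝ) →ₗ[ℝ] (X × ι → ℝ)} {Cc : K → X → Matrix ι ι ℝ} {Ac : K → J ⊕ J → X → Matrix ι ι ℝ}
  {NVc Fl : K → (X × ι → ℝ) →ₗ[ℝ] (X × ι → ℝ)} {Δ NL Yop : (X × ι → ℝ) →ₗ[ℝ] (X × ι → ℝ)} {χX χtX ψX ψ₂X hX : K → X → ℝ} {Sk : K → Set g.Site}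
  {hb : K → g.Site → ℝ} {Tf Tb : K → J → (X × ι → ℝ) →ₗ[ℝ] (X × ι → ℝ)}

set_option maxHeartbeats 800000 in
/-- ★★★ **ENTRY 2 `Y∘∇⁻_ν` FOR ANY RIGHT INVERSE `Y`, FROM FLAT DATA**: n15-c∕168 ★★★ with the true right-locality defects `Ẽ_k := Ñ_{𝒲_k}∘F^flat_k` produced by FILE 148 from the cut flat
cube's defect `F^flat_k`, the adjoint letter by FILE 150, no far defect. [cite: Balaban1985BackgroundPropagators, (3.42) p.397 (entry 2: shape), (3.62)–(3.65) pp.402–403 (mechanism);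
Balaban1984PropagatorsII, (2.91)–(2.93) p.239, (2.133)–(2.136) p.247] -/
theorem hasMaj_rightInverse_bgrad_smoothCutDressed_of_flat     (htri : Triangle254 g) (hd : ∀ a b : g.Site, 0 ≤ g.dist a b) (hsymm : ∀ y y', g.dist y y' = g.dist y' y) (hd0 : ∀ y : g.Site, g.dist y y = 0) (hrow : RowSum g σ cr) (hσ : 0 ≤ σ)
    {ρ₁ ρ₂ ρ₃ ρN δV δN ε R c₀ c₁ c₂ cN rA RN ℓ ω β β₁ ct δ βQ θA θF εE rC r₁ εF Nov : ℝ} (hβ : 0 ≤ β) (hβ₁ : 0 ≤ β₁) (hβQ : 0 ≤ βQ) (hct : 0 ≤ ct) (hR : 0 ≤ R) (hcr : 0 ≤ cr) (hc₀ : 0 ≤ c₀)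
    (hc₁ : 0 ≤ c₁) (hc₂ : 0 ≤ c₂) (hcN : 0 ≤ cN) (hrA : 0 ≤ rA) (hRN : 0 ≤ RN) (hℓ : 0 ≤ ℓ) (hω : 0 ≤ ω) (hθA : 0 ≤ θA) (hθF : 0 ≤ θF) (hεE : 0 ≤ εE) (hNov : 0 ≤ Nov) (hrC : 0 ≤ rC)
    (hr₁ : 0 ≤ r₁) (hεF : 0 ≤ εF) (hε : 0 < ε) (hσρ : σ ≤ ρ₁) (hρ₁V : ρ₁ ≤ δV) (hρ₁G : ρ₁ + σ ≤ δ) (hρ₂ : 0 ≤ ρ₂) (hρ₂₁ : ρ₂ + σ ≤ ρ₁) (hρ₃ : 0 ≤ ρ₃) (hρ₃N : ρ₃ ≤ ρN) (hρ₃V : ρ₃ ≤ δN - ε)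
    (hρ₃₂ : ρ₃ + σ ≤ ρ₂) (hρ₂W : ρ₂ + 2 * σ ≤ ρ₁) (hρ₁N : ρ₁ ≤ δN) (hσρ₃ : 2 * σ ≤ ρ₃)
    -- per cube: cuts (supports over `S_k`, bump letters and insertions, input cuts)
    (hSχ : ∀ k x, χX k x ≠ 0 → blk x ∈ Sk k) (hSψ : ∀ k x, ψX k x ≠ 0 → blk x ∈ Sk k) (hSψ₂ : ∀ k x, ψ₂X k x ≠ 0 → blk x ∈ Sk k) (hχt : ∀ k x, |χtX k x| ≤ 1) (hχ1 : ∀ k x, |χX k x| ≤ 1)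
    (hdχt : ∀ k μ p, |fgrad n (liftEquiv (τ μ) ι) (fun p : X × ι => χtX k p.1) p| ≤ ct) (hdχtb : ∀ k μ p, |bgrad n (liftEquiv (τ μ) ι) (fun p : X × ι => χtX k p.1) p| ≤ ct)
    (hsub : ∀ k, mulOp (fun p : X × ι => χtX k p.1) ∘ₗ mulOp (fun p : X × ι => χX k p.1) = mulOp (fun p : X × ι => χtX k p.1))
    (hχ : ∀ k, mulOp (fun p : X × ι => χX k p.1) ∘ₗ mulOp (fun p : X × ι => χtX k p.1) = mulOp (fun p : X × ι => χtX k p.1))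
    (hs : ∀ k μ, mulOp ((fun p : X × ι => χtX k p.1) ∘ (liftEquiv (τ μ) ι)) ∘ₗ mulOp (fun p : X × ι => χX k p.1) = mulOp ((fun p : X × ι => χtX k p.1) ∘ (liftEquiv (τ μ) ι)))
    (hsb : ∀ k μ, mulOp ((fun p : X × ι => χtX k p.1) ∘ (liftEquiv (τ μ) ι).symm) ∘ₗ mulOp (fun p : X × ι => χX k p.1) = mulOp ((fun p : X × ι => χtX k p.1) ∘ (liftEquiv (τ μ) ι).symm))
    (hdd : ∀ k μ, mulOp (fgrad n (liftEquiv (τ μ) ι) (fun p : X × ι => χtX k p.1)) ∘ₗ mulOp (fun p : X × ι => χX k p.1) = mulOp (fgrad n (liftEquiv (τ μ) ι) (fun p : X × ι => χtX k p.1)))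
    (hddb : ∀ k μ, mulOp (bgrad n (liftEquiv (τ μ) ι) (fun p : X × ι => χtX k p.1)) ∘ₗ mulOp (fun p : X × ι => χX k p.1) = mulOp (bgrad n (liftEquiv (τ μ) ι) (fun p : X × ι => χtX k p.1)))
    (hNψ : ∀ k, N k ∘ₗ mulOp (fun p : X × ι => ψX k p.1) = N k)
    -- per cube: the flat cube's cut rows, SANDWICHED right entries with rows and input cuts
    (hcut : ∀ k, HasMaj (BlockNorm.ofBlocks g (liftBlk blk ι)) (BlockNorm.ofBlocks g (liftBlk blk ι)) (mulOp (fun p : X × ι => χX k p.1) ∘ₗ N k) (fun y y' => ind (Sk k) y * ind (Sk k) y' * (β * Real.exp (-(δ * g.dist y y')))))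
    (hcutF : ∀ k μ, HasMaj (BlockNorm.ofBlocks g (liftBlk blk ι)) (BlockNorm.ofBlocks g (liftBlk blk ι)) (mulOp (fun p : X × ι => χX k p.1) ∘ₗ (fgrad n (liftEquiv (τ μ) ι) ∘ₗ N k)) (fun y y' => ind (Sk k) y * ind (Sk k) y' * (β₁ * Real.exp (-(δ * g.dist y y')))))
    (hcutB : ∀ k μ, HasMaj (BlockNorm.ofBlocks g (liftBlk blk ι)) (BlockNorm.ofBlocks g (liftBlk blk ι)) (mulOp (fun p : X × ι => χX k p.1) ∘ₗ (bgrad n (liftEquiv (τ μ) ι) ∘ₗ N k)) (fun y y' => ind (Sk k) y * ind (Sk k) y' * (β₁ * Real.exp (-(δ * g.dist y y')))))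
    (hTf : ∀ k μ, N k ∘ₗ fgrad n (liftEquiv (τ μ) ι) ∘ₗ mulOp (fun p : X × ι => χX k p.1) = Tf k μ ∘ₗ mulOp (fun p : X × ι => χX k p.1))
    (hTb : ∀ k μ, N k ∘ₗ bgrad n (liftEquiv (τ μ) ι) ∘ₗ mulOp (fun p : X × ι => χX k p.1) = Tb k μ ∘ₗ mulOp (fun p : X × ι => χX k p.1))
    (hTfr : ∀ k μ, HasMaj (BlockNorm.ofBlocks g (liftBlk blk ι)) (BlockNorm.ofBlocks g (liftBlk blk ι)) (Tf k μ) (fun y y' => ind (Sk k) y * ind (Sk k) y' * (βQ * Real.exp (-(δ * g.dist y y')))))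
    (hTbr : ∀ k μ, HasMaj (BlockNorm.ofBlocks g (liftBlk blk ι)) (BlockNorm.ofBlocks g (liftBlk blk ι)) (Tb k μ) (fun y y' => ind (Sk k) y * ind (Sk k) y' * (βQ * Real.exp (-(δ * g.dist y y')))))
    (hTfψ : ∀ k μ, Tf k μ ∘ₗ mulOp (fun p : X × ι => ψ₂X k p.1) = Tf k μ) (hTbψ : ∀ k μ, Tb k μ ∘ₗ mulOp (fun p : X × ι => ψ₂X k p.1) = Tb k μ)
    -- per cube: the cut perturbation's letter, smallness, the adjoint letter of `𝒲_k`
    (hV : ∀ k, HasMaj (BlockNorm.ofBlocks g (blkPair (liftBlk blk ι))) (BlockNorm.ofBlocks g (liftBlk blk ι)) (unstackM (Cc k) (Ac k) + NVc k ∘ₗ projO (none : Option (J ⊕ J))) (fun y y' => R * Real.exp (-(δV * g.dist y y'))))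
    (hq : (β + (β₁ + ct * β)) * (R * cr) * cr < 1) (hqA : θA * cr < 1) (hθAle : β * rC + Fintype.card J * (2 * (βQ * rA + β * r₁)) + β * RN * cr ≤ θA) (hεEle : (1 - θA * cr)⁻¹ * εF * cr ≤ εE)
    -- per cube: the partition, its supports inside `ψ_k`, `χ_k` and its transition layers inside the cut (also shifted by `e_ν`); the partition of unity
    (hhabs : ∀ k x, |hX k x| ≤ 1)
    (hhcut : ∀ k, mulOp (fun p : X × ι => hX k p.1) ∘ₗ mulOp (fun p : X × ι => χX k p.1) = mulOp (fun p : X × ι => hX k p.1))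
    (hh1 : ∀ k μ x, |fgrad n (τ μ) (hX k) x| ≤ c₁) (hh1b : ∀ k μ x, |bgrad n (τ μ) (hX k) x| ≤ c₁) (hh0 : ∀ k μ x, |hX k (τ μ x) - hX k x| ≤ c₀)
    (hLip : ∀ k y y', |hb k y - hb k y'| ≤ ℓ * g.dist y y') (hrh : ∀ k x, |hX k x - hb k (blk x)| ≤ ω)
    (hh2 : ∀ k μ p, |fgradAdj n (liftEquiv (τ μ) ι) (fgrad n (liftEquiv (τ μ) ι) (fun p : X × ι => hX k p.1)) p| ≤ c₂)
    (hh2f : ∀ k μ p, |fgrad n (liftEquiv (τ μ) ι) (fgrad n (liftEquiv (τ μ) ι) (fun p : X × ι => hX k p.1)) p| ≤ c₂)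
    (hh2b : ∀ k μ p, |bgrad n (liftEquiv (τ μ) ι) (bgrad n (liftEquiv (τ μ) ι) (fun p : X × ι => hX k p.1) ∘ ⇑(liftEquiv (τ μ) ι)) p| ≤ c₂)
    (hlayf : ∀ k μ x, hX k x ≠ hX k ((τ μ).symm x) → χX k x = 1) (hlayb : ∀ k μ x, hX k (τ μ x) ≠ hX k x → χX k x = 1) (hlayν : ∀ k x, hX k (τ ν x) ≠ 0 → χX k x = 1)
    (h236 : ∀ p : X × ι, ∑ k, (fun p : X × ι => hX k p.1) p ^ 2 = 1)
    -- per cube: species rows of the cut coefficients, the flat nonlocal commutator letter, base part; overlap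
    (hA : ∀ k j x i, ∑ l, |Ac k j x i l| ≤ rA) (hC : ∀ k x i, ∑ j, |Cc k x i j| ≤ rC)
    (hgAf : ∀ k μ x i, ∑ j, |fgradMat n (τ μ) (Ac k (Sum.inl μ)) x i j| ≤ r₁) (hgAb : ∀ k μ x i, ∑ j, |fgradMat n (τ μ) (Ac k (Sum.inr μ)) x i j| ≤ r₁)
    (hKN : ∀ k, HasMaj (BlockNorm.ofBlocks g (liftBlk blk ι)) (BlockNorm.ofBlocks g (liftBlk blk ι)) (commOp NL (fun p : X × ι => hX k p.1)) (fun y y' => cN * Real.exp (-(ρN * g.dist y y'))))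
    (hNV : ∀ k, HasMaj (BlockNorm.ofBlocks g (liftBlk blk ι)) (BlockNorm.ofBlocks g (liftBlk blk ι)) (NVc k) (fun y y' => RN * Real.exp (-(δN * g.dist y y'))))
    (hN : ∀ a, ∑ k, ind (Sk k) a ≤ Nov)
    -- THE GLOBAL OPERATOR = the cubes' common model (flat part minus GLOBAL species, no far defect); the cut flat cube's right locality on the partition with defect `Fl_k`, its cuts and row; a right inverse
    (hcov₀ : ∀ k, Δ = lapOp n (fun μ => liftEquiv (τ μ) ι) 0 + NL - (unstackM (Cc k) (Ac k) + NVc k ∘ₗ projO (none : Option (J ⊕ J))) ∘ₗ stack LinearMap.id (fun j => Sum.elim (fun μ => fgrad n (liftEquiv (τ μ) ι)) (fun μ => bgrad n (liftEquiv (τ μ) ι)) j))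
    (hflat : ∀ k, (mulOp (fun p : X × ι => χtX k p.1) ∘ₗ N k) ∘ₗ (lapOp n (fun μ => liftEquiv (τ μ) ι) 0 + NL) ∘ₗ mulOp (fun p : X × ι => hX k p.1) = mulOp (fun p : X × ι => hX k p.1) + Fl k)
    (hFlχ : ∀ k, mulOp (fun p : X × ι => χX k p.1) ∘ₗ Fl k = Fl k) (hFlψ : ∀ k, Fl k ∘ₗ mulOp (fun p : X × ι => ψ₂X k p.1) = Fl k)
    (hFl : ∀ k, HasMaj (BlockNorm.ofBlocks g (liftBlk blk ι)) (BlockNorm.ofBlocks g (liftBlk blk ι)) (Fl k) (fun y y' => εF * Real.exp (-(ρ₁ * g.dist y y'))))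
    (hqL : Nov * ((((((Fintype.card J : ℝ) * (3 * ((β + (β₁ + ct * β)) * (1 - (β + (β₁ + ct * β)) * (R * cr) * cr)⁻¹ * c₂) + 2 * (((1 - θA * cr)⁻¹ * βQ * cr) * c₁)) + 0)
          + (β + (β₁ + ct * β)) * (1 - (β + (β₁ + ct * β)) * (R * cr) * cr)⁻¹ * cN * cr)
        + (((Fintype.card J : ℝ) * (2 * rA * (c₁ * ((β + (β₁ + ct * β)) * (1 - (β + (β₁ + ct * β)) * (R * cr) * cr)⁻¹) + c₀ * ((1 - θA * cr)⁻¹ * βQ * cr))))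
          + (β + (β₁ + ct * β)) * (1 - (β + (β₁ + ct * β)) * (R * cr) * cr)⁻¹ * ((ℓ * (Real.exp 1 * ε)⁻¹ + 2 * ω) * RN) * cr)) + θF) + εE) * cr < 1)
    (hY : Δ ∘ₗ Yop = LinearMap.id) :
    HasMaj (BlockNorm.ofBlocks g (liftBlk blk ι)) (BlockNorm.ofBlocks g (liftBlk blk ι)) (Yop ∘ₗ bgrad n (liftEquiv (τ ν) ι))
      (fun y y' => (1 - Nov * ((((((Fintype.card J : ℝ) * (3 * ((β + (β₁ + ct * β)) * (1 - (β + (β₁ + ct * β)) * (R * cr) * cr)⁻¹ * c₂) + 2 * (((1 - θA * cr)⁻¹ * βQ * cr) * c₁)) + 0)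
          + (β + (β₁ + ct * β)) * (1 - (β + (β₁ + ct * β)) * (R * cr) * cr)⁻¹ * cN * cr)
        + (((Fintype.card J : ℝ) * (2 * rA * (c₁ * ((β + (β₁ + ct * β)) * (1 - (β + (β₁ + ct * β)) * (R * cr) * cr)⁻¹) + c₀ * ((1 - θA * cr)⁻¹ * βQ * cr))))
          + (β + (β₁ + ct * β)) * (1 - (β + (β₁ + ct * β)) * (R * cr) * cr)⁻¹ * ((ℓ * (Real.exp 1 * ε)⁻¹ + 2 * ω) * RN) * cr)) + θF) + εE) * cr)⁻¹ *
        (Nov * (((1 - θA * cr)⁻¹ * βQ * cr) * 1 + ((β + (β₁ + ct * β)) * (1 - (β + (β₁ + ct * β)) * (R * cr) * cr)⁻¹) * c₁)) * cr * Real.exp (-((ρ₃ - 2 * σ) * g.dist y y'))) := by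
  have hρ₁0 : 0 ≤ ρ₁ := le_trans hσ hσρ
  have hρ₁δ : ρ₁ ≤ δ := by linarith
  have hinv : 0 ≤ (1 - θA * cr)⁻¹ := inv_nonneg.2 (by linarith)
  have hσρ₃' : 2 * σ ≤ ρ₁ := by linarith
  have hρ₃₁ : ρ₃ ≤ ρ₁ - 2 * σ := by linarith
  have rate₁ : ∀ (T : Set g.Site) {c : ℝ}, 0 ≤ c → ∀ y y' : g.Site,
      ind T y * ind T y' * (c * Real.exp (-(δ * g.dist y y'))) ≤ ind T y * ind T y' * (c * Real.exp (-(ρ₁ * g.dist y y'))) :=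
    fun T c hc y y' => mul_le_mul_of_nonneg_left (exp_rate_mono hd hc hρ₁δ y y') (mul_nonneg (ind_nonneg _ _) (ind_nonneg _ _))
  -- FILE 150 ★★★: the adjoint letter of `𝒲_k`, dominated by `θ_A`
  have hW𝒲 : ∀ k, HasMaj (BlockNorm.ofBlocks g (liftBlk blk ι)) (BlockNorm.ofBlocks g (liftBlk blk ι))
      ((mulOp (fun p : X × ι => χtX k p.1) ∘ₗ N k) ∘ₗ (unstackM (Cc k) (Ac k) + NVc k ∘ₗ projO (none : Option (J ⊕ J))) ∘ₗ
        stack LinearMap.id (fun j => Sum.elim (fun μ => fgrad n (liftEquiv (τ μ) ι)) (fun μ => bgrad n (liftEquiv (τ μ) ι)) j) ∘ₗ mulOp (fun p : X × ι => χX k p.1))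
      (fun y y' => θA * Real.exp (-(ρ₁ * g.dist y y'))) := fun k =>
    (hasMaj_adjW_smoothCut_loc₂ blk τ n htri hd hrow hβ hβQ hrC hrA hr₁ hRN hcr hρ₁0 hρ₁δ hρ₁G hρ₁N (hSχ k) (hχt k) (hχ1 k) (hsub k) (hχ k) (hcut k) (hTf k) (hTb k) (hTfr k) (hTbr k)
      (hC k) (fun μ x i => hA k (Sum.inl μ) x i) (fun μ x i => hA k (Sum.inr μ) x i) (hgAf k) (hgAb k) (hNV k)).mono fun y y' =>
      (mul_le_of_le_one_left (by positivity) (mul_le_one₀ (ind_le_one _ _) (ind_nonneg _ _) (ind_le_one _ _))).trans (mul_le_mul_of_nonneg_right hθAle (Real.exp_nonneg _))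
  -- the units, per cube (as in n15-c∕168)
  have hβb : 0 ≤ β + (β₁ + ct * β) := by positivity
  have hGf := fun k => hasMaj_smoothCut_flat blk (S := Sk k) hβ hβ₁ hct (hχt k) (hsub k) (hcut k)
  have hDf := fun k => hasMaj_jet_smoothCut_flat blk τ n (S := Sk k) hβ hβ₁ hct (hχt k) (hdχt k) (hdχtb k) (hs k) (hsb k) (hdd k) (hddb k) (hcut k) (hcutF k) (hcutB k)
  have hunit := fun k => (hasMaj_dressedV_pair blk htri hd hrow hσ hβb hR hcr hσρ hρ₁V hρ₁G hρ₂ hρ₂₁ (hGf k) (hDf k) (hV k) hq).1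
  have hunitW := fun k => isUnit_neumannR (liftBlk blk ι) hd hrow hθA (by linarith) (hW𝒲 k) hqA
  have hDj : ∀ k, ∀ j, (fun j => Sum.elim (fun μ => fgrad n (liftEquiv (τ μ) ι)) (fun μ => bgrad n (liftEquiv (τ μ) ι)) j ∘ₗ (mulOp (fun p : X × ι => χtX k p.1) ∘ₗ N k)) j = (fun j => Sum.elim (fun μ => fgrad n (liftEquiv (τ μ) ι)) (fun μ => bgrad n (liftEquiv (τ μ) ι)) j) j ∘ₗ (mulOp (fun p : X × ι => χtX k p.1) ∘ₗ N k) := fun _ _ => rfl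
  have hWχ : ∀ k, mulOp (fun p : X × ι => χX k p.1) ∘ₗ ((mulOp (fun p : X × ι => χtX k p.1) ∘ₗ N k) ∘ₗ (unstackM (Cc k) (Ac k) + NVc k ∘ₗ projO (none : Option (J ⊕ J))) ∘ₗ
        stack LinearMap.id (fun j => Sum.elim (fun μ => fgrad n (liftEquiv (τ μ) ι)) (fun μ => bgrad n (liftEquiv (τ μ) ι)) j) ∘ₗ mulOp (fun p : X × ι => χX k p.1)) =
      ((mulOp (fun p : X × ι => χtX k p.1) ∘ₗ N k) ∘ₗ (unstackM (Cc k) (Ac k) + NVc k ∘ₗ projO (none : Option (J ⊕ J))) ∘ₗ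
        stack LinearMap.id (fun j => Sum.elim (fun μ => fgrad n (liftEquiv (τ μ) ι)) (fun μ => bgrad n (liftEquiv (τ μ) ι)) j) ∘ₗ mulOp (fun p : X × ι => χX k p.1)) := fun k => by
    simp only [← LinearMap.comp_assoc]
    rw [hχ k]
  -- FILE 148: the true right-locality defect `Ẽ_k = Ñ_𝒲∘F^flat_k`, exactly, and its two-sided row
  have hloc : ∀ k, (projO none ∘ₗ bgPropV (stack (mulOp (fun p : X × ι => χtX k p.1) ∘ₗ N k) (fun j => Sum.elim (fun μ => fgrad n (liftEquiv (τ μ) ι)) (fun μ => bgrad n (liftEquiv (τ μ) ι)) j ∘ₗ (mulOp (fun p : X × ι => χtX k p.1) ∘ₗ N k))) (unstackM (Cc k) (Ac k) + NVc k ∘ₗ projO (none : Option (J ⊕ J)))) ∘ₗ Δ ∘ₗ mulOp (fun p : X × ι => hX k p.1) =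
      mulOp (fun p : X × ι => hX k p.1) + neumannR ((mulOp (fun p : X × ι => χtX k p.1) ∘ₗ N k) ∘ₗ (unstackM (Cc k) (Ac k) + NVc k ∘ₗ projO (none : Option (J ⊕ J))) ∘ₗ
        stack LinearMap.id (fun j => Sum.elim (fun μ => fgrad n (liftEquiv (τ μ) ι)) (fun μ => bgrad n (liftEquiv (τ μ) ι)) j) ∘ₗ mulOp (fun p : X × ι => χX k p.1)) ∘ₗ Fl k := fun k => by
    have h := projO_dressedV_comp_lap_mulOp (hDj k) (hunit k) (smoothCut_out (hχ k)) (hunitW k) (Δ₀ := lapOp n (fun μ => liftEquiv (τ μ) ι) 0 + NL)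
      (Vt := (unstackM (Cc k) (Ac k) + NVc k ∘ₗ projO (none : Option (J ⊕ J))) ∘ₗ stack LinearMap.id (fun j => Sum.elim (fun μ => fgrad n (liftEquiv (τ μ) ι)) (fun μ => bgrad n (liftEquiv (τ μ) ι)) j)) (Vm := 0) (hcov₀ k) (hflat k) (by rw [add_zero]) (hFlχ k)
    rw [LinearMap.comp_zero, add_zero] at h
    exact h
  have hEd : ∀ k, HasMaj (BlockNorm.ofBlocks g (liftBlk blk ι)) (BlockNorm.ofBlocks g (liftBlk blk ι)) (neumannR ((mulOp (fun p : X × ι => χtX k p.1) ∘ₗ N k) ∘ₗ (unstackM (Cc k) (Ac k) + NVc k ∘ₗ projO (none : Option (J ⊕ J))) ∘ₗ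
        stack LinearMap.id (fun j => Sum.elim (fun μ => fgrad n (liftEquiv (τ μ) ι)) (fun μ => bgrad n (liftEquiv (τ μ) ι)) j) ∘ₗ mulOp (fun p : X × ι => χX k p.1)) ∘ₗ Fl k)
      (fun y y' => ind (Sk k) y * ind (Sk k) y' * (εE * Real.exp (-(ρ₃ * g.dist y y')))) := fun k =>
    (hasMaj_neumannR_comp_loc₂ blk htri hd hd0 hrow hσ hcr (hSχ k) (hSψ₂ k) (hWχ k) (hFlχ k) (hFlψ k) hεF hθA hσρ₃' (hW𝒲 k) (hFl k) hqA).mono fun y y' =>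
      mul_le_mul_of_nonneg_left ((exp_rate_mono hd (c := (1 - θA * cr)⁻¹ * εF * cr) (by positivity) hρ₃₁ y y').trans
        (mul_le_mul_of_nonneg_right hεEle (Real.exp_nonneg _))) (mul_nonneg (ind_nonneg _ _) (ind_nonneg _ _))
  -- no far defect
  have hFK : ∀ k, HasMaj (BlockNorm.ofBlocks g (liftBlk blk ι)) (BlockNorm.ofBlocks g (liftBlk blk ι)) ((projO none ∘ₗ bgPropV (stack (mulOp (fun p : X × ι => χtX k p.1) ∘ₗ N k) (fun j => Sum.elim (fun μ => fgrad n (liftEquiv (τ μ) ι)) (fun μ => bgrad n (liftEquiv (τ μ) ι)) j ∘ₗ (mulOp (fun p : X × ι => χtX k p.1) ∘ₗ N k))) (unstackM (Cc k) (Ac k) + NVc k ∘ₗ projO (none : Option (J ⊕ J)))) ∘ₗ commOp (0 : (X × ι → ℝ) →ₗ[ℝ] (X × ι → ℝ)) (fun p : X × ι => hX k p.1))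
      (fun y y' => ind (Sk k) y * (θF * Real.exp (-(ρ₃ * g.dist y y')))) := fun k => by
    rw [show commOp (0 : (X × ι → ℝ) →ₗ[ℝ] (X × ι → ℝ)) (fun p : X × ι => hX k p.1) = 0 from by simp [commOp], LinearMap.comp_zero]
    exact (hasMaj_zero _ _).mono fun y y' => mul_nonneg (ind_nonneg _ _) (mul_nonneg hθF (Real.exp_nonneg _))
  exact hasMaj_rightInverse_bgrad_smoothCutDressed blk τ n ν (F := fun _ => 0) htri hd hsymm hd0 hrow hσ hβ hβ₁ hβQ hct hR hcr hc₀ hc₁ hc₂ hcN hrA hRN hℓ hω hθA hθF hεE hNov hε hσρ hρ₁V hρ₁G hρ₂ hρ₂₁ hρ₃ hρ₃N hρ₃V hρ₃₂ hρ₂W hσρ₃ hSχ hSψ hSψ₂ hχt hχ1 hdχt hdχtb hsub hχ hs hsb hdd hddb hNψ hcut hcutF hcutB hTf hTb (fun k μ => (hTfr k μ).mono (rate₁ (Sk k) hβQ)) (fun k μ => (hTbr k μ).mono (rate₁ (Sk k) hβQ)) hTfψ hTbψ hV hq hW𝒲 hqA hhabs hhcut hh1 hh1b hh0 hLip hrh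 hh2 hh2f hh2b hlayf hlayb hlayν h236 hA hKN hNV hN (fun k => by rw [add_zero]; exact hcov₀ k) hFK hloc hEd hqL hY

end Capstone

end Summit.QuantumFields.YangMills.BalabanUVNodes.N15.Gluing

end
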